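import Summits.HodgeConjecture.HodgeConjecture.Theorems.MarkmanPartnerTransportPicardThreeK3SquaresZeta11Theta
import Summits.HodgeConjecture.HodgeConjecture.Theorems.MarkmanPartnerTransportLowPicardRMPartneredLossless

/-!
# Route MarkmanPartnerTransport · crux #5 `LowPicardRealMultiplication` (stmt-HodgeConjecture-19653) —
# «ZETA11-X»: the cell-(3,5) partnered conjunct on the `θ₁₁ = zeta11Theta` locus, and HC⁴(X) there, BY NAME

Cell hodge-nonav, chapter ROUTE-P1AL; planner p1 g40 ASSIGN (N) «ZETA11-X» (2026-08-28T19:49Z); prover seat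
hodge-nonav-20241-p1 (gen 16). Leaf (imports the route file through `…LowPicardRMPartneredLossless`);
`--supports stmt-HodgeConjecture-19653` helper. NO new named fact.

The first BY-NAME `X`-side instance INSIDE an open cell of crux #5: the K3 side is g11's
`Zeta11ModelExists.hodgeConjectureFor_square_of_zeta11Theta` (HC⁴(S ⊗ S) for every marked projective K3 surface whose
real-multiplication generator is conjugate by a rational isometry of `Λ_ℚ` to the NAMED model `(zeta11Theta)_ℂ` of the
van Geemen–Schütt ζ₁₁ family; modulo {`Buskin2019_hodgeIsometry_algebraic`,
`VanGeemenSchuett2025_OguisoZhang2011_zeta11_cycleOnOpenPeriodSet`}); the `X` side is `PartnerTransport` and the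
«PARTNERED LOSSLESS IFF» of this seat:

* **`hodgeConjectureFor_of_partner_zeta11Theta`** — `HodgeConjectureFor 4 X` for EVERY marked smooth projective
  `K3^{[2]}`-type `(X, φ, P, z)` with a ledger partner `(S, η, p, x, g)` (route K3 marking + (g1), (g2), (g5)) whose
  surface carries a generating endomorphism `t` of the `θ₁₁` type (g11's hypotheses verbatim); g11's
  `hodgeConjectureFor_of_zeta11Partner` re-anchored on the named model; mod {Buskin, vGS∕OZ fact, Beauville incidence,
  Beauville blow-up, Markman lift, Voisin cup};
* **`oneCycleK3_of_partner_zeta11Theta`** — if moreover `X` is a cell member (`RMgen[X, φ, z, d]`), then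
  `OneCycleK3[S, hS, d]`: the PARTNERED CONJUNCT `PartneredOneCycleK3` of `lowPicardRealMultiplication_iff_ledger` holds
  on the `θ₁₁` locus (`exists_oneCycleK3_of_partner_of_hodgeConjectureFor`, i.e. HC⁴(S⊗S) ⟹ HC⁴(X) ⟹ one cycle on `S`;
  adds {O'Grady, Markman isometry-algebraic, Verbitsky–Guan, Charles–Markman}); for `ρ(S) = 2` these `X` are the
  partnered members of cell `(3,5)` of that type (`d = 5` is read off the `RMgen` datum, no degree certificate);
* **`hodgeConjectureFor_hilbertSquare_zeta11Theta`** — the Hilbert square: for Beauville's marked Hilbert square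
  `(H, φ_H, P_H, (x,0))` of such an `S`, `HodgeConjectureFor 4 H` (partnered by `partner_incidence`).

CONDITIONAL on the displayed named facts; nothing here constructs a cycle off the vGS family or proves the cell, the
crux, or HC. The honest content: on the θ₁₁ rational RM type the open input of cell `(3,5)` is supplied IN PRINT
(vGS Thm. 1.1 (11) + §5.8 maximality + Oguiso–Zhang), so its partnered members are settled modulo the facts.

References: B. van Geemen, M. Schütt, Forum Math. Sigma 13 (2025) e2, Thm. 1.1 (11), §4.8, §5.8; K. Oguiso, D.-Q. Zhang,
Pure Appl. Math. Q. 7 (2011) Thm. 1.5; E. Markman, Compos. Math. 160 (2024) Thm. 1.1, 1.4; A. Beauville, J. Differential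
Geom. 18 (1983) §6; N. Buskin, J. reine angew. Math. 755 (2019) Thm. 1.1.
-/

noncomputable section

set_option linter.dupNamespace false

open scoped Matrix
open Module CategoryTheory MonoidalCategory Polynomial
open Literature.AlgebraicTopology.SingularHomology Literature.Geometry.Kaehler
open Literature.AlgebraicGeometry Literature.AlgebraicGeometry.Motives Literature.AlgebraicGeometry.HodgeTheory
open Literature.AlgebraicGeometry.Hyperkaehler Literature.AlgebraicGeometry.Surfaces
open Literature.AlgebraicGeometry.HilbertScheme
open Summit.HodgeConjecture.HodgeConjecture.Theorems.NikulinTwinTransport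
open Summit.HodgeConjecture.HodgeConjecture.Theorems.MarkmanPartnerTransport.BBFPositivity

namespace Summit.HodgeConjecture.HodgeConjecture.Theorems.MarkmanPartnerTransport.PartnerLattice

/-- `MarkedK3Sq[X, φ, P, z]`: VERBATIM the `let MarkedK3Sq := …` binder of the route declarations of
MarkmanPartnerTransport (clauses (m1)–(m6)). Local notation only. -/
local notation3 (prettyPrint := false) "MarkedK3Sq[" X ", " φ ", " P ", " z "]" =>
  (((IsIntegralClass P ∧ ∀ Q : complexBetti X (2 * 4), IsIntegralClass Q → ∃ n : ℤ, Q = n • P) ∧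
    (∀ c : complexBetti X 2, IsIntegralClass c ↔ ∃ v : K3HilbertIndex → ℤ, φ c = fun i => (v i : ℂ)) ∧
    (∀ a : complexBetti X 2, cupPowTwo a 4 = ((3 : ℂ) * (k3HilbertForm 2 (φ a) (φ a)) ^ 2) • P) ∧
    (IsOfHodgeType 4 X 2 2 0 (LinearEquiv.symm φ z) ∧
      ∀ τ : complexBetti X 2, IsOfHodgeType 4 X 2 2 0 τ → ∃ t : ℂ, τ = t • LinearEquiv.symm φ z) ∧
    (∀ c : complexBetti X 2, IsOfHodgeType 4 X 2 1 1 c ↔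
      (k3HilbertForm 2 (φ c) z = 0 ∧ k3HilbertForm 2 (φ c) (star z) = 0)) ∧
    (k3HilbertForm 2 z z = 0 ∧ 0 < (k3HilbertForm 2 (star z) z).re)))

/-- `MarkedK3[S, η, p, x]`: VERBATIM the `let MarkedK3 := …` binder of the route declarations (`p ≠ 0`, the six
marking clauses, the projective period point). Local notation only. -/
local notation3 (prettyPrint := false) "MarkedK3[" S ", " η ", " p ", " x "]" =>
  (p ≠ 0 ∧ (IsIntegralClass p ∧
    (∀ q : complexBetti S (2 * 2), IsIntegralClass q → ∃ n : ℤ, q = n • p) ∧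
    (∀ c : complexBetti S (2 * 1), IsIntegralClass c ↔ ∃ v : K3Index → ℤ, η c = fun i => (v i : ℂ)) ∧
    (∀ a b : complexBetti S (2 * 1),
      cupProduct (rfl : 2 * 1 + 2 * 1 = 2 * 2) a b = k3Form (η a) (η b) • p) ∧
    IsOfHodgeType 2 S (2 * 1) 2 0 (LinearEquiv.symm η x) ∧
    (∀ τ : complexBetti S (2 * 1), IsOfHodgeType 2 S (2 * 1) 2 0 τ →
      ∃ t : ℂ, τ = t • LinearEquiv.symm η x)) ∧
    (k3Form x x = 0 ∧ 0 < (k3Form (star x) x).re ∧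
      ∃ u : K3Index → ℤ, k3Form (fun i => (u i : ℂ)) x = 0 ∧ 0 < ∑ i, ∑ j, u i * k3Gram i j * u j))

/-- `RMgen[X, φ, z, d]` (VERBATIM `…LowPicardRMCells`). Local notation only. -/
local notation3 (prettyPrint := false) "RMgen[" X ", " φ ", " z ", " d "]" =>
  (∃ θ : complexBetti X 2 →ₗ[ℂ] complexBetti X 2, (∀ y, IsRationalClass y → IsRationalClass (θ y)) ∧
    (∀ (i j : ℕ) y, IsOfHodgeType 4 X 2 i j y → IsOfHodgeType 4 X 2 i j (θ y)) ∧
    (∀ y w : complexBetti X 2, k3HilbertForm 2 (φ (θ y)) (φ w) = k3HilbertForm 2 (φ y) (φ (θ w))) ∧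
    ∃ ev : ℂ, θ (LinearEquiv.symm φ z) = ev • LinearEquiv.symm φ z ∧ ev.im = 0 ∧
      (minpoly ℚ ev).natDegree = d ∧
      (∃ n : ℕ, 3 ≤ n ∧ d * n + Module.finrank ℂ ↥(algebraicClasses X 1) = 23) ∧
      ∀ f : complexBetti X 2 →ₗ[ℂ] complexBetti X 2, (∀ y, IsRationalClass y → IsRationalClass (f y)) →
        (∀ (i j : ℕ) y, IsOfHodgeType 4 X 2 i j y → IsOfHodgeType 4 X 2 i j (f y)) →
        ∃ c : Fin d → ℚ, ∀ y : complexBetti X 2,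
          (∀ a : complexBetti X 2, a ∈ algebraicClasses X 1 → k3HilbertForm 2 (φ y) (φ a) = 0) →
            f y = ∑ i : Fin d, ((c i : ℂ) • (θ ^ (i : ℕ)) y))

/-- `Partner[X, φ, S, η, g]`: clauses (g1), (g2), (g5) of the route's `IsK3Partner` datum — `g : H²(S) → H²(X)`
rational, type-preserving, isometric on cup-transcendental classes (the clauses `partnerTransport_explicit` uses).
Local notation only. -/
local notation3 (prettyPrint := false) "Partner[" X ", " φ ", " S ", " η ", " g "]" =>
  ((∀ a, IsRationalClass a → IsRationalClass (g a)) ∧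
    (∀ (i j : ℕ) a, IsOfHodgeType 2 S (2 * 1) i j a → IsOfHodgeType 4 X 2 i j (g a)) ∧
    (∀ a b, (∀ d ∈ algebraicClasses S 1, cupProduct (rfl : 2 * 1 + 2 * 1 = 2 * 2) a d = 0) →
      (∀ d ∈ algebraicClasses S 1, cupProduct (rfl : 2 * 1 + 2 * 1 = 2 * 2) b d = 0) →
      k3HilbertForm 2 (φ (g a)) (φ (g b)) = k3Form (η a) (η b)))

/-- `OneCycleK3[S, hS, d]`: ONE cycle-induced transcendental endomorphism of the K3 surface `S` (rational,
type-preserving, kills `N¹`, image `⊥ N¹`, induced by an algebraic class on `S × S`) whose `(2,0)`-eigenvalue has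
minimal polynomial of degree `d`. Local notation only. -/
local notation3 (prettyPrint := false) "OneCycleK3[" S ", " hS ", " d "]" =>
  (∃ t : complexBetti S (2 * 1) →ₗ[ℂ] complexBetti S (2 * 1),
    IsCycleInducedTranscendentalEndomorphism S (IsK3Surface.isSmoothProjective hS) t ∧
    ∃ (σ₁ : complexBetti S (2 * 1)) (ev : ℂ), IsOfHodgeType 2 S (2 * 1) 2 0 σ₁ ∧ σ₁ ≠ 0 ∧
      t σ₁ = ev • σ₁ ∧ (minpoly ℚ ev).natDegree = d)

/-- `Zeta11Gen[S, η, t]`: the θ₁₁-type clauses on an endomorphism `t` of `H²(S(ℂ); ℂ)`, VERBATIM the binders of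
`Zeta11ModelExists.hodgeConjectureFor_square_of_zeta11Theta` (rational, type-preserving, kills `N¹`, image `⊥ N¹`,
annihilated on `T(S)` by a separable `P` with `P(0) ≠ 0`, generating, conjugate by a rational isometry `σ` of `Λ_ℚ` to
`(zeta11Theta)_ℂ`). Local notation only. -/
local notation3 (prettyPrint := false) "Zeta11Gen[" S ", " η ", " t "]" =>
  ((∃ P : ℚ[X], P.Separable ∧ P.eval 0 ≠ 0 ∧ IsAnnihilatedOnTranscendentalBy S t P) ∧
    (∀ y, IsRationalClass y → IsRationalClass (t y)) ∧
    (∀ (i j : ℕ) (y : complexBetti S (2 * 1)), IsOfHodgeType 2 S (2 * 1) i j y → IsOfHodgeType 2 S (2 * 1) i j (t y)) ∧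
    (∀ d ∈ algebraicClasses S 1, t d = 0) ∧
    (∀ (y : complexBetti S (2 * 1)), ∀ d ∈ algebraicClasses S 1,
      cupProduct (rfl : 2 * 1 + 2 * 1 = 2 * 2) (t y) d = 0) ∧
    TranscendentalEndomorphismsGeneratedBy S t ∧
    ∃ σ : Module.End ℂ (K3Index → ℂ), (∀ a b, k3Form (σ a) (σ b) = k3Form a b) ∧
      (∀ v : K3Index → ℤ, ∃ w : K3Index → ℚ, σ (fun i => (v i : ℂ)) = fun i => (w i : ℂ)) ∧
      ∀ c : complexBetti S (2 * 1), σ (η (t c)) = thetaC zeta11Theta (σ (η c)))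

variable {X S : SchemeOver ℂ} {φ : complexBetti X 2 ≃ₗ[ℂ] (K3HilbertIndex → ℂ)} {P : complexBetti X (2 * 4)}
  {z : K3HilbertIndex → ℂ} {η : complexBetti S (2 * 1) ≃ₗ[ℂ] (K3Index → ℂ)} {p : complexBetti S (2 * 2)}
  {x : K3Index → ℂ}

/-- **HC⁴(S ⊗ S) on the θ₁₁ locus, packaged** (g11's `hodgeConjectureFor_square_of_zeta11Theta` with the clauses bundled as
`Zeta11Gen`). [cite: GeemenSchutt2023, Thm. 1.1 (11) and §5.8] [cite: OguisoZhang2011K3Order11, Thm. 1.5 (3)] [cite: Buskin2019, Thm. 1.1] -/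
theorem hodgeConjectureFor_square_of_zeta11Gen (hB : Buskin2019_hodgeIsometry_algebraic)
    (hVGS : VanGeemenSchuett2025_OguisoZhang2011_zeta11_cycleOnOpenPeriodSet) (hS : IsK3Surface S)
    (hMS : MarkedK3[S, η, p, x]) {t : complexBetti S (2 * 1) →ₗ[ℂ] complexBetti S (2 * 1)} (ht : Zeta11Gen[S, η, t]) :
    HodgeConjectureFor 4 (S ⊗ S) := by
  obtain ⟨⟨Q, hQsep, hQ0, hQt⟩, h1, h2, h3, h4, hgen, σ, hσ, hσrat, hconj⟩ := ht
  exact Zeta11ModelExists.hodgeConjectureFor_square_of_zeta11Theta hB hVGS hS hQsep hQ0 η p x hMS t h1 h2 h3 h4 hQt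
    hgen σ hσ hσrat hconj

/-- **HC⁴(X) for every `K3^{[2]}`-type fourfold with a ledger partner of θ₁₁ type** (module docstring): `PartnerTransport`
applied to g11's theorem. Modulo {Buskin, vGS∕OZ open-family fact, Beauville incidence, Beauville blow-up, Markman lift,
Voisin cup}. [cite: GeemenSchutt2023, Thm. 1.1 (11), §4.8, §5.8] [cite: Markman2024, §1.1 Thm. 1.1 and Thm. 1.4]
[cite: Beauville1983, §6 (e)–(f), Prop. 6] [cite: Buskin2019, Thm. 1.1] -/
theorem hodgeConjectureFor_of_partner_zeta11Theta (hB : Buskin2019_hodgeIsometry_algebraic)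
    (hVGS : VanGeemenSchuett2025_OguisoZhang2011_zeta11_cycleOnOpenPeriodSet)
    (hBI : Beauville1983_hilbertSquare_markedIncidence) (hBea : Beauville1983_hilbertSquare_blowupDiagonal_surjection)
    (hMk : Markman2024_rationalHodgeIsometry_lift_algebraic_marked) (hcup : Voisin2003_cupProduct_algebraicClasses)
    (hX : IsSmoothProjective 4 X) (hK : IsOfK3HilbertSquareType X) (hM : MarkedK3Sq[X, φ, P, z]) (hS : IsK3Surface S)
    (hMS : MarkedK3[S, η, p, x]) {g : complexBetti S (2 * 1) →ₗ[ℂ] complexBetti X 2} (hg : Partner[X, φ, S, η, g])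
    {t : complexBetti S (2 * 1) →ₗ[ℂ] complexBetti S (2 * 1)} (ht : Zeta11Gen[S, η, t]) : HodgeConjectureFor 4 X := by
  have hsq := hodgeConjectureFor_square_of_zeta11Gen hB hVGS hS hMS ht
  obtain ⟨_, hmk, hxx, hxpos, hu⟩ := hMS
  obtain ⟨hg1, hg2, hg5⟩ := hg
  exact partnerTransport_explicit hBI hBea hMk hcup hX hK hM hS hmk hxx hxpos hu hg1 hg2 hg5 hsq

/-- **The PARTNERED CONJUNCT of the crux-5 ledger holds on the θ₁₁ locus**: a cell member `X` (`RMgen[X, φ, z, d]`) with a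
ledger partner `S` of θ₁₁ type has `OneCycleK3[S, hS, d]` — HC⁴(S ⊗ S) (g11) ⟹ HC⁴(X) (`PartnerTransport`) ⟹ one
cycle-induced endomorphism of eigenvalue degree `d` on `S` (`exists_oneCycleK3_of_partner_of_hodgeConjectureFor`). For
`ρ(S) = 2` these are the partnered members of cell `(3,5)` of the θ₁₁ type. Modulo the displayed facts.
[cite: GeemenSchutt2023, Thm. 1.1 (11) and §4.8] [cite: Markman2024, §1.1 Thm. 1.1] [cite: CharlesMarkman2013, Thm. 1.1 (§1)] -/
theorem oneCycleK3_of_partner_zeta11Theta (hB : Buskin2019_hodgeIsometry_algebraic)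
    (hVGS : VanGeemenSchuett2025_OguisoZhang2011_zeta11_cycleOnOpenPeriodSet)
    (hBI : Beauville1983_hilbertSquare_markedIncidence) (hBea : Beauville1983_hilbertSquare_blowupDiagonal_surjection)
    (hO : OGrady2008_dualBBFClass_algebraic) (hMk : Markman2024_rationalHodgeIsometry_lift_algebraic_marked)
    (hcup : Voisin2003_cupProduct_algebraicClasses) (hMkI : Markman2024_rationalHodgeIsometry_algebraic_marked)
    (hV : VerbitskyGuan_cohomology_K3HilbertSquareType) (hCM : CharlesMarkman2013_lefschetzStandard_K3HilbertType)
    (hX : IsSmoothProjective 4 X) (hK : IsOfK3HilbertSquareType X) (hM : MarkedK3Sq[X, φ, P, z]) {d : ℕ}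
    (hR : RMgen[X, φ, z, d]) (hS : IsK3Surface S) (hMS : MarkedK3[S, η, p, x])
    {g : complexBetti S (2 * 1) →ₗ[ℂ] complexBetti X 2} (hg : Partner[X, φ, S, η, g])
    {t : complexBetti S (2 * 1) →ₗ[ℂ] complexBetti S (2 * 1)} (ht : Zeta11Gen[S, η, t]) : OneCycleK3[S, hS, d] :=
  exists_oneCycleK3_of_partner_of_hodgeConjectureFor hBI hO hcup hMkI hV hCM hX hK hM hR hS hMS hg
    (hodgeConjectureFor_of_partner_zeta11Theta hB hVGS hBI hBea hMk hcup hX hK hM hS hMS hg ht)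

/-- **HC⁴ of the Hilbert square of a K3 surface of θ₁₁ type** — Beauville's marked Hilbert square `(H, φ_H, P_H, (x,0))`
is partnered by the incidence (`partner_incidence`); for `ρ(S) = 2` it is a member of cell `(3,5)`. Modulo {Buskin,
vGS∕OZ fact, Beauville incidence, Beauville blow-up, Markman lift, Voisin cup}. [cite: GeemenSchutt2023, Thm. 1.1 (11)]
[cite: Beauville1983, §6 Prop. 6] [cite: Markman2024, §1.1 Thm. 1.1 and Thm. 1.4] -/
theorem hodgeConjectureFor_hilbertSquare_zeta11Theta (hB : Buskin2019_hodgeIsometry_algebraic)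
    (hVGS : VanGeemenSchuett2025_OguisoZhang2011_zeta11_cycleOnOpenPeriodSet)
    (hBI : Beauville1983_hilbertSquare_markedIncidence) (hBea : Beauville1983_hilbertSquare_blowupDiagonal_surjection)
    (hMk : Markman2024_rationalHodgeIsometry_lift_algebraic_marked) (hcup : Voisin2003_cupProduct_algebraicClasses)
    {H : SchemeOver ℂ} {φH : complexBetti H 2 ≃ₗ[ℂ] (K3HilbertIndex → ℂ)} {PH : complexBetti H (2 * 4)}
    (hH : IsSmoothProjective 4 H) (hKH : IsOfK3HilbertSquareType H) (hMH : MarkedK3Sq[H, φH, PH, Sum.elim x 0])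
    (hS : IsK3Surface S) (hMS : MarkedK3[S, η, p, x]) {θ : complexBetti (H ⊗ S) (2 * 2)}
    (hi : ∀ a : complexBetti S (2 * 1),
      φH (corrAction complexOrientationFamily hH (IsK3Surface.isSmoothProjective hS)
        (rfl : 2 * 1 + 2 * 2 = 2 + 2 * 2) θ a) = Sum.elim (η a) 0)
    {t : complexBetti S (2 * 1) →ₗ[ℂ] complexBetti S (2 * 1)} (ht : Zeta11Gen[S, η, t]) : HodgeConjectureFor 4 H := by
  obtain ⟨hp0, ⟨-, -, hηint, hcupS, h20, h20span⟩, -, hxpos, -⟩ := id hMS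
  exact hodgeConjectureFor_of_partner_zeta11Theta hB hVGS hBI hBea hMk hcup hH hKH hMH hS hMS
    (partner_incidence hS hp0 hηint hcupS h20 h20span hxpos hH hMH hi) ht

end Summit.HodgeConjecture.HodgeConjecture.Theorems.MarkmanPartnerTransport.PartnerLattice

end
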